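import Literature.IUT.HodgeTheaters.GlobalFrobenioidsCoricModel
import HarnessLib

/-!
# [IUTchI] Example 5.1 (v), p. 129 l. 5–24: "any ∞κ×-coric structure determines an ∞κ-coric structure" —
# DERIVED from the Remark 3.1.7 (ii) torsion criterion (proof-only companion; sub-DAG row E51/L31)

S. Mochizuki, *Inter-universal Teichmüller theory I*, kurims manuscript (May 2020), §5 Example 5.1 (v), p. 129
l. 5–24: "One may also define … ∞κ×-coric structures on †ℱ^⊛.  Then an easy translation 'via Kummer theory' of the
discussion of Remark 3.1.7, (ii), reveals that any ∞κ×-coric structure †𝕄^⊛_∞κ× on †ℱ^⊛ determines an ∞κ-coric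
structure [i.e., 'ι((†𝕄^⊛_∞κ×)^κ)' in the discussion of Remark 3.1.7, (ii)] †𝕄^⊛_∞κ by considering the subset of
elements for which the restriction of the associated Kummer class [i.e., as in the above discussion] to some
[or, equivalently, every] subgroup of π₁^rat(†𝒟^⊛) that corresponds to an open subgroup of the decomposition
group of some strictly critical point of C_{F_mod} is a torsion element [i.e., corresponds to a root of
unity]"; §3 Remark 3.1.7 (ii) p. 67: "an ∞κ×-coric element f is ∞κ-coric if and only if it restricts to a root
of unity at some [or, equivalently, every] strictly critical point of the compactification |C_L|^{cpt}"
([IUTchI] Ex 5.1 (v) p.129, Rmk 3.1.7 (ii) p.67) [claim: Mochizuki2012, status: disputed] (D-0012 claim key,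
series status DISPUTED; the content here is set-theoretic bookkeeping over abc-iut-L5-t1/t12's typed vocabulary —
nothing disputed is involved and no side is taken on [IUTchIII] Cor. 3.12).

## What is proved (cell abc-iut, sub-DAG `plan/L5/SUBDAG-IUTchI-Ex51.md` row E51/L31, previously «∅»)

abc-iut-L5-t12 typed the display as the predicate `CoricPair.DeterminesInfκStructure κ R modelInfκ`
(`GlobalFrobenioidsInfKappa.lean`): (a) "some [or, equivalently, every]", (b) the torsion locus is
`π₁^rat(†𝒟^⊛)`-stable, (c) the sub-pair on the torsion locus IS an ∞κ-coric structure (isomorphic to the model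
∞κ-pair).  This file CLOSES it — for the model ∞κ×-pair `N.infκxPair` of abc-iut-w5-d110's `GlobalFrobenioidsCoricModel`,
and for ANY ∞κ×-coric structure `P` along a structure isomorphism `e : P ⥲ N.infκxPair` — from the ONE printed input,
the Remark 3.1.7 (ii) TORSION CRITERION read through the Kummer restriction data `R` at the interface:
"an ∞κ×-coric rational function is ∞κ-coric iff its Kummer class restricts to a torsion element at SOME subgroup of
the family" (`hsome`) "iff at EVERY subgroup of the family" (`hevery`).  The criterion is an explicit HYPOTHESIS
(an interface law of the Kummer-map / decomposition-group merge; its MODEL FORM at abc-iut-L5-t2's rational typing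
is PROVED: `CriticalLocus.inftyKappaUnitCoricCriterion_holds`, `KappaCoricFunctionsProofs.lean`) — not a fact.

* `CoricPair.Iso.nonempty_iso_restrict` — an isomorphism of pairs restricts to matched `Γ`-stable subsets
  (pure bookkeeping for t12's `CoricPair.restrict`);
* `NFBridgeRecon.nonempty_iso_restrict_infκPair` — the sub-pair of the model ∞κ×-pair on "the elements lying in
  `𝕄^⊛_∞κ`" IS the model ∞κ-pair (`𝕄^⊛_∞κ ⊆ 𝕄^⊛_∞κ×`, p. 128);
* **`NFBridgeRecon.determinesInfκStructure_infκxPair_of_criterion`** — (v) p. 129 l. 5–24 for the model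
  ∞κ×-pair; **`NFBridgeRecon.determinesInfκStructure_of_criterion`** — the same for any ∞κ×-coric structure `P`
  (criterion read along its structure isomorphism `e`);
* `NFBridgeRecon.torsionLocus_eq_of_criterion` — under the criterion the torsion locus is exactly `e⁻¹(𝕄^⊛_∞κ)`;
  `NFBridgeRecon.determinesInfκStructure_comp_of_criterion` — with the Kummer map transported from the model
  (`κ := κx ∘ e`) the criterion is needed at the model pair only.

PROOF-ONLY: no definition, no instance, no notation, no new Prop fact.  typed ≠ proved elsewhere; the criterion
binder is an ASSUMPTION LABEL at the genuine data.
-/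

namespace Literature.IUT.HodgeTheaters

universe u

/-! ### Restricting an isomorphism of pairs to matched stable subsets -/

section Restrict

variable {Γ : Type u} [Group Γ] [TopologicalSpace Γ]

namespace CoricPair

/-- An isomorphism of pairs `e : P ⥲ Q` restricts to an isomorphism of the sub-pairs on `Γ`-stable subsets
`S ⊆ P`, `T ⊆ Q` that correspond under `e` (abc-iut-L5-t12's `CoricPair.restrict`; the partial multiplications
are the restricted ones).  Stated as `Nonempty` (proof-only file). ([IUTchI] Ex 5.1 (v) p.129)
[claim: Mochizuki2012, status: disputed] -/
theorem Iso.nonempty_iso_restrict {P Q : CoricPair Γ} (e : Iso P Q) (S : SubMulAction Γ P.carrier)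
    (T : SubMulAction Γ Q.carrier) (h : ∀ x : P.carrier, x ∈ S ↔ e.toEquiv x ∈ T) :
    Nonempty (Iso (P.restrict S) (Q.restrict T)) := by
  -- the underlying bijection `S ≃ T` (the carriers of the restricted pairs are the subtypes `↥S`, `↥T`)
  let ε : S ≃ T :=
    { toFun := fun x => ⟨e.toEquiv (x : P.carrier), (h _).mp x.2⟩
      invFun := fun y => ⟨e.toEquiv.symm (y : Q.carrier),
        (h _).mpr (by rw [Equiv.apply_symm_apply]; exact y.2)⟩
      left_inv := fun x => Subtype.ext (e.toEquiv.symm_apply_apply _)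
      right_inv := fun y => Subtype.ext (e.toEquiv.apply_symm_apply _) }
  have hε : ∀ x : S, ((ε x : T) : Q.carrier) = e.toEquiv (x : P.carrier) := fun _ => rfl
  refine ⟨{ toEquiv := ε
            smul := fun g (x : S) => Subtype.ext (e.smul g (x : P.carrier))
            dom := fun (p : S × S) => ?_
            op := fun (p : {q : S × S // q ∈ (P.restrict S).pm.dom}) =>
              Subtype.ext (e.op ⟨((p.1.1 : P.carrier), (p.1.2 : P.carrier)), p.2.1⟩) }⟩
  change (∃ hd : ((p.1 : P.carrier), (p.2 : P.carrier)) ∈ P.pm.dom, P.pm.op ⟨_, hd⟩ ∈ S) ↔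
    ∃ hd : (((ε p.1 : T) : Q.carrier), ((ε p.2 : T) : Q.carrier)) ∈ Q.pm.dom, Q.pm.op ⟨_, hd⟩ ∈ T
  simp only [hε]
  constructor
  · rintro ⟨hd, hS⟩
    refine ⟨(e.dom (_, _)).mp hd, ?_⟩
    have hop := e.op ⟨((p.1 : P.carrier), (p.2 : P.carrier)), hd⟩
    rw [← hop]
    exact (h _).mp hS
  · rintro ⟨hd, hT⟩
    have hd' : ((p.1 : P.carrier), (p.2 : P.carrier)) ∈ P.pm.dom := (e.dom (_, _)).mpr hd
    refine ⟨hd', ?_⟩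
    have hop := e.op ⟨((p.1 : P.carrier), (p.2 : P.carrier)), hd'⟩
    apply (h _).mpr
    rw [hop]
    exact hT

end CoricPair

end Restrict

/-! ### The model: `𝕄^⊛_∞κ` inside `𝕄^⊛_∞κ×`, and the criterion -/

namespace NFBridgeRecon

variable (N : NFBridgeRecon.{u})

/-- The sub-pair of the model ∞κ×-pair `π₁^rat(†𝒟^⊛) ↷ 𝕄^⊛_∞κ×(†𝒟^⊚)` on [a stable subset whose elements are
exactly] the ∞κ-coric functions IS the model ∞κ-pair `π₁^rat(†𝒟^⊛) ↷ 𝕄^⊛_∞κ(†𝒟^⊚)` — `𝕄^⊛_∞κ ⊆ 𝕄^⊛_∞κ×` with the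
restricted multiplication and action (p. 128 "`†𝕄^⊛_∞κ ↪ †𝕄^⊛_∞κ×`"). ([IUTchI] Ex 5.1 (v) p.128)
[claim: Mochizuki2012, status: disputed] -/
theorem nonempty_iso_restrict_infκPair (S : SubMulAction N.piRat N.infκxPair.carrier)
    (hS : ∀ x : N.infκxPair.carrier, x ∈ S ↔ (x : N.Krat) ∈ N.Minfκ) :
    Nonempty (CoricPair.Iso (N.infκxPair.restrict S) N.infκPair) := by
  let ε : S ≃ N.infκPair.carrier :=
    { toFun := fun x => ⟨((x : N.infκxPair.carrier) : N.Krat), (hS _).mp x.2⟩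
      invFun := fun y => ⟨⟨(y : N.Krat), N.minfκ_subset y.2⟩, (hS _).mpr y.2⟩
      left_inv := fun x => rfl
      right_inv := fun y => rfl }
  refine ⟨{ toEquiv := ε
            smul := fun g (x : S) => rfl
            dom := fun (p : S × S) => ?_
            op := fun (p : {q : S × S // q ∈ (N.infκxPair.restrict S).pm.dom}) => rfl }⟩
  change (∃ hd : (((p.1 : N.infκxPair.carrier) : N.Krat) * ((p.2 : N.infκxPair.carrier) : N.Krat) ∈ N.Minfκx),
      (⟨_, hd⟩ : N.infκxPair.carrier) ∈ S) ↔
    ((p.1 : N.infκxPair.carrier) : N.Krat) * ((p.2 : N.infκxPair.carrier) : N.Krat) ∈ N.Minfκ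
  constructor
  · rintro ⟨_hd, hS'⟩
    exact (hS _).mp hS'
  · intro hm
    exact ⟨N.minfκ_subset hm, (hS _).mpr hm⟩

/-- Under the Remark 3.1.7 (ii) torsion criterion (`hsome`), the torsion locus of the model ∞κ×-pair is exactly
the set of ∞κ-coric functions. ([IUTchI] Ex 5.1 (v) p.129) [claim: Mochizuki2012, status: disputed] -/
theorem mem_torsionLocus_infκxPair_iff {H : Type u} [CommGroup H] (κ : N.infκxPair.carrier → H)
    (R : CriticalRestrictionData N.piRat H)
    (hsome : ∀ f : N.infκxPair.carrier,
      (f : N.Krat) ∈ N.Minfκ ↔ ∃ i : R.Idx, IsOfFinOrder (R.res i (κ f)))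
    (x : N.infκxPair.carrier) : x ∈ CoricPair.torsionLocus κ R ↔ (x : N.Krat) ∈ N.Minfκ :=
  (hsome x).symm

/-- **Ex. 5.1 (v), p. 129 l. 5–24, for the model ∞κ×-pair**: given the Kummer map `κ` on `𝕄^⊛_∞κ×(†𝒟^⊚)` and
the restriction data `R` [restriction of Kummer classes to (open subgroups of) decomposition groups of strictly
critical points], IF the Remark 3.1.7 (ii) torsion criterion holds at the interface — an ∞κ×-coric rational
function is ∞κ-coric iff its Kummer class restricts to a torsion element at SOME subgroup of the family (`hsome`),
iff at EVERY one (`hevery`) — THEN `κ, R` DETERMINE the ∞κ-coric structure: (a) "some [or, equivalently,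
every]", (b) the torsion locus is `π₁^rat`-stable, (c) the sub-pair on it is [isomorphic to] the model ∞κ-pair.
PROVED from the criterion; the criterion is an explicit hypothesis (interface law; model form PROVED by
abc-iut-L5-t2, `CriticalLocus.inftyKappaUnitCoricCriterion_holds`). ([IUTchI] Ex 5.1 (v) p.129)
[claim: Mochizuki2012, status: disputed] -/
theorem determinesInfκStructure_infκxPair_of_criterion {H : Type u} [CommGroup H]
    (κ : N.infκxPair.carrier → H) (R : CriticalRestrictionData N.piRat H)
    (hsome : ∀ f : N.infκxPair.carrier,
      (f : N.Krat) ∈ N.Minfκ ↔ ∃ i : R.Idx, IsOfFinOrder (R.res i (κ f)))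
    (hevery : ∀ f : N.infκxPair.carrier,
      (f : N.Krat) ∈ N.Minfκ ↔ ∀ i : R.Idx, IsOfFinOrder (R.res i (κ f))) :
    CoricPair.DeterminesInfκStructure κ R N.infκPair := by
  have hloc : ∀ x : N.infκxPair.carrier, x ∈ CoricPair.torsionLocus κ R ↔ (x : N.Krat) ∈ N.Minfκ :=
    N.mem_torsionLocus_infκxPair_iff κ R hsome
  have hsmul : ∀ (g : N.piRat) {x : N.infκxPair.carrier},
      x ∈ CoricPair.torsionLocus κ R → g • x ∈ CoricPair.torsionLocus κ R := by
    intro g x hx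
    rw [hloc] at hx ⊢
    exact N.smul_mem_minfκ g hx
  exact ⟨fun x => (hsome x).symm.trans (hevery x), hsmul,
    ⟨N.nonempty_iso_restrict_infκPair ⟨CoricPair.torsionLocus κ R, hsmul⟩ hloc⟩⟩

/-- Under the criterion read along a structure isomorphism `e : P ⥲ 𝕄^⊛_∞κ×(†𝒟^⊚)`, the torsion locus of an
∞κ×-coric structure `P` is exactly `e⁻¹(𝕄^⊛_∞κ(†𝒟^⊚))`. ([IUTchI] Ex 5.1 (v) p.129)
[claim: Mochizuki2012, status: disputed] -/
theorem torsionLocus_eq_of_criterion {P : CoricPair N.piRat} {H : Type u} [CommGroup H]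
    (κ : P.carrier → H) (R : CriticalRestrictionData N.piRat H) (e : CoricPair.Iso P N.infκxPair)
    (hsome : ∀ x : P.carrier,
      ((e.toEquiv x : N.infκxPair.carrier) : N.Krat) ∈ N.Minfκ ↔ ∃ i : R.Idx, IsOfFinOrder (R.res i (κ x))) :
    CoricPair.torsionLocus κ R = {x | ((e.toEquiv x : N.infκxPair.carrier) : N.Krat) ∈ N.Minfκ} :=
  Set.ext fun x => (hsome x).symm

/-- **Ex. 5.1 (v), p. 129 l. 5–24, for ANY ∞κ×-coric structure** `π₁^rat(†𝒟^⊛) ↷ P` on `†ℱ^⊛` [a pair isomorphic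
to the model ∞κ×-pair; `e` a structure isomorphism, `κ` its Kummer map, `R` the restriction data]: IF the
Remark 3.1.7 (ii) torsion criterion holds for the elements of `P` read through `e` (`hsome`/`hevery`), THEN
"`†𝕄^⊛_∞κ×` determines an ∞κ-coric structure `†𝕄^⊛_∞κ`": abc-iut-L5-t12's `DeterminesInfκStructure κ R` relative to
the model ∞κ-pair `𝕄^⊛_∞κ(†𝒟^⊚)` — the torsion locus is `e⁻¹(𝕄^⊛_∞κ)`, `π₁^rat`-stable, and the sub-pair on it is
isomorphic to the model ∞κ-pair via `e`.  PROVED from the criterion (an explicit hypothesis, not a fact).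
([IUTchI] Ex 5.1 (v) p.129) [claim: Mochizuki2012, status: disputed] -/
theorem determinesInfκStructure_of_criterion {P : CoricPair N.piRat} {H : Type u} [CommGroup H]
    (κ : P.carrier → H) (R : CriticalRestrictionData N.piRat H) (e : CoricPair.Iso P N.infκxPair)
    (hsome : ∀ x : P.carrier,
      ((e.toEquiv x : N.infκxPair.carrier) : N.Krat) ∈ N.Minfκ ↔ ∃ i : R.Idx, IsOfFinOrder (R.res i (κ x)))
    (hevery : ∀ x : P.carrier,
      ((e.toEquiv x : N.infκxPair.carrier) : N.Krat) ∈ N.Minfκ ↔ ∀ i : R.Idx, IsOfFinOrder (R.res i (κ x))) :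
    CoricPair.DeterminesInfκStructure κ R N.infκPair := by
  have hloc : ∀ x : P.carrier,
      x ∈ CoricPair.torsionLocus κ R ↔ ((e.toEquiv x : N.infκxPair.carrier) : N.Krat) ∈ N.Minfκ :=
    fun x => (hsome x).symm
  have hsmul : ∀ (g : N.piRat) {x : P.carrier},
      x ∈ CoricPair.torsionLocus κ R → g • x ∈ CoricPair.torsionLocus κ R := by
    intro g x hx
    rw [hloc] at hx ⊢
    rw [e.smul]
    exact N.smul_mem_minfκ g hx
  -- the matching stable subset of the model ∞κ×-pair: "the elements lying in `𝕄^⊛_∞κ`"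
  let T : SubMulAction N.piRat N.infκxPair.carrier :=
    ⟨{y | (y : N.Krat) ∈ N.Minfκ}, fun g _ hy => N.smul_mem_minfκ g hy⟩
  have hT : ∀ y : N.infκxPair.carrier, y ∈ T ↔ (y : N.Krat) ∈ N.Minfκ := fun _ => Iff.rfl
  obtain ⟨e₁⟩ := e.nonempty_iso_restrict ⟨CoricPair.torsionLocus κ R, hsmul⟩ T hloc
  obtain ⟨e₂⟩ := N.nonempty_iso_restrict_infκPair T hT
  exact ⟨fun x => (hsome x).symm.trans (hevery x), hsmul, ⟨⟨e₁.trans e₂⟩⟩⟩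

/-- The same with the Kummer map of `P` TRANSPORTED from the model's along the structure isomorphism
(`κ := κx ∘ e`, cf. abc-iut-w5-d110's `CoricPair.KummerRealization.ofIso`): then the criterion needs to be known
ONLY at the model ∞κ×-pair (`hsome`/`hevery` for `κx`), and every ∞κ×-coric structure `P` determines its ∞κ-coric
structure. ([IUTchI] Ex 5.1 (v) p.129) [claim: Mochizuki2012, status: disputed] -/
theorem determinesInfκStructure_comp_of_criterion {P : CoricPair N.piRat} {H : Type u} [CommGroup H]
    (κx : N.infκxPair.carrier → H) (R : CriticalRestrictionData N.piRat H) (e : CoricPair.Iso P N.infκxPair)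
    (hsome : ∀ f : N.infκxPair.carrier,
      (f : N.Krat) ∈ N.Minfκ ↔ ∃ i : R.Idx, IsOfFinOrder (R.res i (κx f)))
    (hevery : ∀ f : N.infκxPair.carrier,
      (f : N.Krat) ∈ N.Minfκ ↔ ∀ i : R.Idx, IsOfFinOrder (R.res i (κx f))) :
    CoricPair.DeterminesInfκStructure (κx ∘ e.toEquiv) R N.infκPair :=
  N.determinesInfκStructure_of_criterion (κx ∘ e.toEquiv) R e (fun x => hsome (e.toEquiv x))
    (fun x => hevery (e.toEquiv x))

end NFBridgeRecon

end Literature.IUT.HodgeTheaters
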